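import Summits.Ventures.HodgeRepro2.T5CornerSimple
import Summits.Ventures.HodgeRepro2.T5DirectedIdempotents

/-!
# The level dictionary closed: `π^K = e_K π` on both sides (Tier-5 kernel support, seat p8)

Two bookkeeping identities tying the group side (`invariants ρ K`, `T4-B5`'s `LevelPositivity`)
to the Hecke side (`cornerModule e M`, `T5CornerSimple`) through the level idempotent: the corner
`e_K • V` of `End_k V` at `e_K` IS the subspace of `K`-invariants
(`cornerModule_levelIdempotent_eq`), so `V^K` carries the `e_K End_k(V) e_K`-module structure of
`T5CornerSimple` (`mem_cornerModule_levelIdempotent_iff`); a non-zero smooth representation has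
non-zero `K`-invariants for some `K` of a cofinal family (`exists_invariants_ne_bot_of_isSmooth`;
the exhaustion `⨆ V^{K_i} = V` itself is `T5SchurRepresentation.iSup_invariants_eq_top`, not
restated here).  Nothing is asserted about any specific group.
-/

namespace Summit.Ventures.HodgeRepro2.T5LevelDictionary

open Summit.Ventures.HodgeRepro2.LevelPositivity Summit.Ventures.HodgeRepro2.T5LevelIdempotent
  Summit.Ventures.HodgeRepro2.T5CornerSimple Summit.Ventures.HodgeRepro2.T5DirectedIdempotents

variable {G : Type*} [Group G] {k : Type*} [Field k] {V : Type*} [AddCommGroup V] [Module k V]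
  (ρ : Representation k G V)

section Corner

variable [CharZero k] {K : Subgroup G} (hK : KFinite ρ K)

/-- The corner `e_K • V` of `End_k V` at the level idempotent is the subspace of `K`-invariants. -/
theorem cornerModule_levelIdempotent_eq :
    cornerModule (levelIdempotent (ρ := ρ) K hK) V = (invariants ρ K).toAddSubgroup := by
  ext v
  rw [mem_cornerModule_iff (isIdempotentElem_levelIdempotent ρ K hK), Submodule.mem_toAddSubgroup,
    Module.End.smul_def, levelIdempotent_apply]
  haveI := hK v
  exact levelAverage_eq_self_iff

/-- `v ∈ e_K • V` iff `v` is `K`-invariant. -/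
theorem mem_cornerModule_levelIdempotent_iff {v : V} :
    v ∈ cornerModule (levelIdempotent (ρ := ρ) K hK) V ↔ v ∈ invariants ρ K := by
  rw [cornerModule_levelIdempotent_eq ρ hK, Submodule.mem_toAddSubgroup]

/-- `e_K • V = range e_K = V^K`. -/
theorem cornerModule_levelIdempotent_eq_range :
    cornerModule (levelIdempotent (ρ := ρ) K hK) V =
      (LinearMap.range (levelIdempotent (ρ := ρ) K hK)).toAddSubgroup := by
  rw [cornerModule_levelIdempotent_eq ρ hK, range_levelIdempotent]

end Corner

/-- The `K`-invariants are non-decreasing as `K` shrinks, in dimension too. -/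
theorem finrank_invariants_mono {K' K : Subgroup G} (hle : K' ≤ K)
    [FiniteDimensional k (invariants ρ K')] :
    Module.finrank k (invariants ρ K) ≤ Module.finrank k (invariants ρ K') :=
  Submodule.finrank_mono (invariants_mono hle)

section Smooth

variable [TopologicalSpace G] [IsTopologicalGroup G]

omit [IsTopologicalGroup G] in
/-- A non-zero smooth representation has non-zero `K`-invariants for some `K` in a cofinal
family. -/
theorem exists_invariants_ne_bot_of_isSmooth (hρ : IsSmooth ρ) (𝒦 : Set (Subgroup G))
    (hcof : ∀ U : Subgroup G, IsOpen (U : Set G) → ∃ K ∈ 𝒦, K ≤ U) [Nontrivial V] :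
    ∃ K ∈ 𝒦, invariants ρ K ≠ ⊥ := by
  obtain ⟨v, hv⟩ := exists_ne (0 : V)
  obtain ⟨K, hK, hle⟩ := hcof (stabilizer ρ v) (hρ v)
  have hvK : v ∈ invariants ρ K := mem_invariants_iff.2 fun g hg => mem_stabilizer_iff.1 (hle hg)
  exact ⟨K, hK, fun h => hv ((Submodule.mem_bot k).1 (h ▸ hvK))⟩

end Smooth

end Summit.Ventures.HodgeRepro2.T5LevelDictionary
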